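/-
Copyright (c) 2026 the pub-hodgecm-mathlib formalisation cell (harness21).  Prover seat hodgecm-mathlib-A-p12 (g24), 2026-09-02.  «S3-ram» seeding wave (LEAD F0P3a-plan (g12∕g13);
owner F0P3a-p06 (g15); (Cnt2′) chair F0P3a-p07 (g14)): organ (B-ii) «SHELL CLASS LAW» of the (α₂) TYPE-(2) line, file 2f «FREE CENTRING SCALAR» (⊇ ★ 2e p847825).
Kernel lane, `--supports stmt-HodgeConjecture-24833`.
-/
import Literature.NumberTheory.Rogawski1990.DepthZeroKappaTransferTypeTwoRamifiedShellClassLawOdd    -- ★ p847825 (this seat) file 2e: the parity-free law, the odd law; ⊇ ★ 2a–2d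
import HarnessLib

/-!
# The shell class law with a free centring scalar: `CLS^c_{c′}(Y) :⟺ ∃ y ∈ 𝒪_w², a ∈ 𝒪_w^×, |ϖ₁·ᵗσ_w(y)J(Y − c·1)y − c′a²|_w < 1` for ANY `c ∈ L_w`
# (Labesse–Langlands 1979 §2; Rogawski 1990 §4.9)

Topic `NumberTheory/Rogawski1990`; namespace `Literature.NumberTheory.Automorphic.UnitaryGroup`.  THEOREMS ONLY (no definition, no instance, no notation, no named fact,
no `sorry`); kernel lane `--supports stmt-HodgeConjecture-24833`.  Cell `pub/hodgecm-mathlib` (D-0151), crux H413; «S3-ram» (count-neutral); seat A-p12 (g24).  HONEST LABEL: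
HC_CM is proved only modulo the cell's 2 remaining named inputs (hLiu418 24832, h413 24833) until rung 0 closes; nothing printed is asserted here.

THE MATHEMATICS.  ★ 2b∕2e state the class law with the class token centred at `c = ½ tr γ_{2,w}` (`Y − c·1` traceless); the proof uses only `P(Y − c·1)P⁻¹ = PYP⁻¹ − c·1`,
valid for ANY scalar `c`.  The (Cnt2′) W-side lattice tokens (F0P3a-p07 (g14) ★ `UnitaryLatticeTreeAxisCountTransport` ED. 2: `CLS(c₀) := ∃ y ∈ B, ∃ a, |a| = 1 ∧
|ϖ⁻¹·pairing σ H₂ y ((γ₂ − 1) *ᵥ y) − c₀a²| < 1`) are centred at `c = 1`; this file restates the parity-free master and its even∕odd-depth instances with `c` FREE, so that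
the W-side pack can take `c := 1` (and any scale `ϖ₁`, any `GL₂(𝒪_w)`-stable family `S`).

* §1 **`natCard_class_eq_natCard_class_of_flip_scalar`**.
* §2 **`natCard_class_eq_natCard_class_of_even_depth_ramified_scalar`**, **`natCard_class_eq_natCard_class_of_odd_depth_ramified_scalar`**.

## References
* [LabesseLanglands1979] J.-P. Labesse, R. P. Langlands, *L-indistinguishability for SL(2)*, Canad. J. Math. 31 (1979): §2 pp. 7–8.
* [Rogawski1990] J. D. Rogawski, *Automorphic Representations of Unitary Groups in Three Variables* (1990): §4.9 pp. 54–56.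
* [Jacobowitz1962] R. Jacobowitz, *Hermitian forms over local fields*, Amer. J. Math. 84 (1962): §7–§8.
-/

set_option autoImplicit false

noncomputable section

open MeasureTheory Measure Set NumberField IsDedekindDomain Matrix ValuativeRel MulAction Finset Polynomial
open scoped ValuativeRel Matrix MatrixGroups WithZero

namespace Literature.NumberTheory.Automorphic.UnitaryGroup

open Literature.NumberTheory.Rogawski1990 Literature.NumberTheory.Automorphic Literature.NumberTheory.Automorphic.IntegralReduction
open Literature.NumberTheory.Automorphic.HermitianLatticeTree Literature.GroupTheory Literature.NumberTheory.GaloisRepresentations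

/-! ## §1 The class law from a flip, with a free centring scalar `c` -/

section FlipLawScalar

variable (L : Type) [Field L] [NumberField L] [IsCMField L] (v : HeightOneSpectrum (𝓞 ↥(maximalRealSubfield L)))
  (w : PlacesOver L v) (hw : IsCMField.complexConj L • w.1 = w.1)

set_option maxHeartbeats 1600000 in
include hw in
/-- **THE CLASS LAW FROM A FLIP, FREE CENTRING SCALAR.**  ★ 2e `natCard_class_eq_natCard_class_of_flip` VERBATIM except that the centring scalar of the class token is a FREE
`c ∈ L_w` (2e fixes `c = ½ tr γ_{2,w}`; the W-side lattice tokens of the (Cnt2′) rows use `c = 1`, ★ `ncard_selfDual_fixed_axis_rankOne_class_eq`): given, for every unit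
`c′`, a similitude `X₀` of `(L_w², J)` with unit multiplier `ι(ν) ≡ c′`, commuting with `γ_{2,w}` and normalising `U`, then for every `GL₂(𝒪_w)`-stable `S`, scale `ϖ₁`, centring
`c` and units `c₀, c₁`: **`#{hK⁰ : S(Y_h) ∧ CLS^c_{c₀}(Y_h)} = #{hK⁰ : S(Y_h) ∧ CLS^c_{c₁}(Y_h)}`**, `CLS^c_{c′}(Y) :⟺ ∃ y ∈ 𝒪_w², a ∈ 𝒪_w^×, |ϖ₁·ᵗσ_w(y)J(Y − c·1)y − c′a²|_w < 1`
(the transport `P(Y − c·1)P⁻¹ = PYP⁻¹ − c·1` holds for any scalar). [cite: LabesseLanglands1979, §2 pp. 7–8] [cite: Rogawski1990, §4.9 p. 55] [cite: Jacobowitz1962, §8] -/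
theorem natCard_class_eq_natCard_class_of_flip_scalar (he : v.asIdeal.ramificationIdx' w.1.asIdeal ≠ 1) (h2 : IsUnit (2 : 𝒪[(w.1.adicCompletion L)]))
    (γ₂ : ((cmDatum L 2 (Matrix.of fun i j : Fin 2 => if i.val + j.val + 1 = 2 then (1 : L) else 0)).Local v))
    (hflip : ∀ c : (w.1.adicCompletion L), Valued.v c = 1 → ∃ (X₀ : GL (Fin 2) (w.1.adicCompletion L)) (ν : (v.adicCompletion ↥(maximalRealSubfield L))),
      ((X₀ : Matrix (Fin 2) (Fin 2) (w.1.adicCompletion L)).map (galAdicCompletionMap (L := L) (IsCMField.complexConj L) hw))ᵀ * !![(0 : (w.1.adicCompletion L)), 1; 1, 0] * (X₀ : Matrix (Fin 2) (Fin 2) (w.1.adicCompletion L)) = toPlace v w ν • !![(0 : (w.1.adicCompletion L)), 1; 1, 0] ∧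
      valuation (v.adicCompletion ↥(maximalRealSubfield L)) ν = 1 ∧ Valued.v (toPlace v w ν - c) < 1 ∧
      (X₀ : Matrix (Fin 2) (Fin 2) (w.1.adicCompletion L)) * ((((localNonsplitEquiv (IsCMField.complexConj L) (Matrix.of fun i j : Fin 2 => if i.val + j.val + 1 = 2 then (1 : L) else 0) (IsCMField.complexConj_ne_one L) w hw) (γ₂) : ↥(unitaryGroupOfForm (galAdicCompletionMap (L := L) (IsCMField.complexConj L) hw) (placeForm (Matrix.of fun i j : Fin 2 => if i.val + j.val + 1 = 2 then (1 : L) else 0) w.1))) : GL (Fin 2) (w.1.adicCompletion L)) : Matrix (Fin 2) (Fin 2) (w.1.adicCompletion L)) = ((((localNonsplitEquiv (IsCMField.complexConj L) (Matrix.of fun i j : Fin 2 => if i.val + j.val + 1 = 2 then (1 : L) else 0) (IsCMField.complexConj_ne_one L) w hw) (γ₂) : ↥(unitaryGroupOfForm (galAdicCompletionMap (L := L) (IsCMField.complexConj L) hw) (placeForm (Matrix.of fun i j : Fin 2 => if i.val + j.val + 1 = 2 then (1 : L) else 0) w.1))) : GL (Fin 2) (w.1.adicCompletion L)) : Matrix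 (Fin 2) (Fin 2) (w.1.adicCompletion L)) * (X₀ : Matrix (Fin 2) (Fin 2) (w.1.adicCompletion L)) ∧
      ∀ h : GL (Fin 2) (w.1.adicCompletion L), h ∈ unitaryGroupOfForm (galAdicCompletionMap (L := L) (IsCMField.complexConj L) hw) (placeForm (Matrix.of fun i j : Fin 2 => if i.val + j.val + 1 = 2 then (1 : L) else 0) w.1) → X₀ * h * X₀⁻¹ ∈ unitaryGroupOfForm (galAdicCompletionMap (L := L) (IsCMField.complexConj L) hw) (placeForm (Matrix.of fun i j : Fin 2 => if i.val + j.val + 1 = 2 then (1 : L) else 0) w.1))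
    (S : Matrix (Fin 2) (Fin 2) (w.1.adicCompletion L) → Prop) (hS : ∀ P : GL (Fin 2) (w.1.adicCompletion L), P ∈ glInt 2 (w.1.adicCompletion L) → ∀ Y : Matrix (Fin 2) (Fin 2) (w.1.adicCompletion L), S Y → S ((P : Matrix (Fin 2) (Fin 2) (w.1.adicCompletion L)) * Y * ((P⁻¹ : GL (Fin 2) (w.1.adicCompletion L)) : Matrix (Fin 2) (Fin 2) (w.1.adicCompletion L))))
    (ϖ₁ c : (w.1.adicCompletion L)) {c₀ c₁ : (w.1.adicCompletion L)} (hc₀ : Valued.v c₀ = 1) (hc₁ : Valued.v c₁ = 1) :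
    Nat.card {x : ((cmDatum L 2 (Matrix.of fun i j : Fin 2 => if i.val + j.val + 1 = 2 then (1 : L) else 0)).Local v) ⧸ (cmLocalIntegralLevel L 2 (Matrix.of fun i j : Fin 2 => if i.val + j.val + 1 = 2 then (1 : L) else 0) v) | ∃ h : ((cmDatum L 2 (Matrix.of fun i j : Fin 2 => if i.val + j.val + 1 = 2 then (1 : L) else 0)).Local v), x = (h : ((cmDatum L 2 (Matrix.of fun i j : Fin 2 => if i.val + j.val + 1 = 2 then (1 : L) else 0)).Local v) ⧸ (cmLocalIntegralLevel L 2 (Matrix.of fun i j : Fin 2 => if i.val + j.val + 1 = 2 then (1 : L) else 0) v)) ∧ S (((((localNonsplitEquiv (IsCMField.complexConj L) (Matrix.of fun i j : Fin 2 => if i.val + j.val + 1 = 2 then (1 : L) else 0) (IsCMField.complexConj_ne_one L) w hw) (h⁻¹ * γ₂ * h) : ↥(unitaryGroupOfForm (galAdicCompletionMap (L := L) (IsCMField.complexConj L) hw) (placeForm (Matrix.of fun i j : Fin 2 => if i.val + j.val + 1 = 2 then (1 : L) else 0) w.1))) : GL (Fin 2) (w.1.adicCompletion L)) : Matrix (Fin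 2) (Fin 2) (w.1.adicCompletion L))) ∧
      ∃ (y : Fin 2 → (w.1.adicCompletion L)) (a : (w.1.adicCompletion L)), (∀ i, Valued.v (y i) ≤ 1) ∧ Valued.v a = 1 ∧
        Valued.v (ϖ₁ * ((fun i => (galAdicCompletionMap (L := L) (IsCMField.complexConj L) hw) (y i)) ⬝ᵥ (!![(0 : (w.1.adicCompletion L)), 1; 1, 0] *ᵥ ((((((localNonsplitEquiv (IsCMField.complexConj L) (Matrix.of fun i j : Fin 2 => if i.val + j.val + 1 = 2 then (1 : L) else 0) (IsCMField.complexConj_ne_one L) w hw) (h⁻¹ * γ₂ * h) : ↥(unitaryGroupOfForm (galAdicCompletionMap (L := L) (IsCMField.complexConj L) hw) (placeForm (Matrix.of fun i j : Fin 2 => if i.val + j.val + 1 = 2 then (1 : L) else 0) w.1))) : GL (Fin 2) (w.1.adicCompletion L)) : Matrix (Fin 2) (Fin 2) (w.1.adicCompletion L)) - c • (1 : Matrix (Fin 2) (Fin 2) (w.1.adicCompletion L))) *ᵥ y))) - c₀ * a ^ 2) < 1} =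
    Nat.card {x : ((cmDatum L 2 (Matrix.of fun i j : Fin 2 => if i.val + j.val + 1 = 2 then (1 : L) else 0)).Local v) ⧸ (cmLocalIntegralLevel L 2 (Matrix.of fun i j : Fin 2 => if i.val + j.val + 1 = 2 then (1 : L) else 0) v) | ∃ h : ((cmDatum L 2 (Matrix.of fun i j : Fin 2 => if i.val + j.val + 1 = 2 then (1 : L) else 0)).Local v), x = (h : ((cmDatum L 2 (Matrix.of fun i j : Fin 2 => if i.val + j.val + 1 = 2 then (1 : L) else 0)).Local v) ⧸ (cmLocalIntegralLevel L 2 (Matrix.of fun i j : Fin 2 => if i.val + j.val + 1 = 2 then (1 : L) else 0) v)) ∧ S (((((localNonsplitEquiv (IsCMField.complexConj L) (Matrix.of fun i j : Fin 2 => if i.val + j.val + 1 = 2 then (1 : L) else 0) (IsCMField.complexConj_ne_one L) w hw) (h⁻¹ * γ₂ * h) : ↥(unitaryGroupOfForm (galAdicCompletionMap (L := L) (IsCMField.complexConj L) hw) (placeForm (Matrix.of fun i j : Fin 2 => if i.val + j.val + 1 = 2 then (1 : L) else 0) w.1))) : GL (Fin 2) (w.1.adicCompletion L)) : Matrix (Fin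 2) (Fin 2) (w.1.adicCompletion L))) ∧
      ∃ (y : Fin 2 → (w.1.adicCompletion L)) (a : (w.1.adicCompletion L)), (∀ i, Valued.v (y i) ≤ 1) ∧ Valued.v a = 1 ∧
        Valued.v (ϖ₁ * ((fun i => (galAdicCompletionMap (L := L) (IsCMField.complexConj L) hw) (y i)) ⬝ᵥ (!![(0 : (w.1.adicCompletion L)), 1; 1, 0] *ᵥ ((((((localNonsplitEquiv (IsCMField.complexConj L) (Matrix.of fun i j : Fin 2 => if i.val + j.val + 1 = 2 then (1 : L) else 0) (IsCMField.complexConj_ne_one L) w hw) (h⁻¹ * γ₂ * h) : ↥(unitaryGroupOfForm (galAdicCompletionMap (L := L) (IsCMField.complexConj L) hw) (placeForm (Matrix.of fun i j : Fin 2 => if i.val + j.val + 1 = 2 then (1 : L) else 0) w.1))) : GL (Fin 2) (w.1.adicCompletion L)) : Matrix (Fin 2) (Fin 2) (w.1.adicCompletion L)) - c • (1 : Matrix (Fin 2) (Fin 2) (w.1.adicCompletion L))) *ᵥ y))) - c₁ * a ^ 2) < 1} := by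
  have hc₁0 : c₁ ≠ 0 := fun h0 => by rw [h0, map_zero] at hc₁; exact zero_ne_one hc₁
  -- the class-flipping similitude with `ι(ν) ≡ c₀c₁⁻¹`, and its unitary correction
  obtain ⟨X₀, ν, hsim, hν, hνc, hcomm, hnorm⟩ := hflip (c₀ * c₁⁻¹) (by rw [map_mul, map_inv₀, hc₀, hc₁, inv_one, mul_one])
  obtain ⟨k₀, hk₀U, hPint⟩ := exists_unitary_inv_mul_mem_glInt_of_similitude L v w hw he h2 X₀ hν hsim
  have hk₀J : k₀ ∈ unitaryGroupOfForm (galAdicCompletionMap (L := L) (IsCMField.complexConj L) hw) !![(0 : (w.1.adicCompletion L)), 1; 1, 0] := by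
    rw [← unitaryGroupOfForm_placeForm_antidiagTwo_eq]; exact hk₀U
  have hιν : Valued.v (toPlace v w ν) = 1 := by rw [valued_toPlace, (v_eq_one_iff_valuation_eq_one _).2 hν, one_pow]
  have hιν0 : toPlace v w ν ≠ 0 := fun h0 => by rw [h0, map_zero] at hιν; exact zero_ne_one hιν
  -- `X₀⁻¹` normalises `U` as well
  have hsim' := similitude_inv (galAdicCompletionMap (L := L) (IsCMField.complexConj L) hw) X₀ hιν0 hsim
  have hnorm' : ∀ h : GL (Fin 2) (w.1.adicCompletion L), h ∈ unitaryGroupOfForm (galAdicCompletionMap (L := L) (IsCMField.complexConj L) hw) (placeForm (Matrix.of fun i j : Fin 2 => if i.val + j.val + 1 = 2 then (1 : L) else 0) w.1) → X₀⁻¹ * h * X₀ ∈ unitaryGroupOfForm (galAdicCompletionMap (L := L) (IsCMField.complexConj L) hw) (placeForm (Matrix.of fun i j : Fin 2 => if i.val + j.val + 1 = 2 then (1 : L) else 0) w.1) := by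
    intro h hh
    rw [unitaryGroupOfForm_placeForm_antidiagTwo_eq] at hh ⊢
    have h1 := conj_mem_unitaryGroupOfForm_of_similitude (galAdicCompletionMap (L := L) (IsCMField.complexConj L) hw) X₀⁻¹ hsim' h hh
    rwa [inv_inv] at h1
  -- GL-level commutation with `u = E₂ γ₂`
  have hcommGL : X₀ * (((localNonsplitEquiv (IsCMField.complexConj L) (Matrix.of fun i j : Fin 2 => if i.val + j.val + 1 = 2 then (1 : L) else 0) (IsCMField.complexConj_ne_one L) w hw) γ₂ : ↥(unitaryGroupOfForm (galAdicCompletionMap (L := L) (IsCMField.complexConj L) hw) (placeForm (Matrix.of fun i j : Fin 2 => if i.val + j.val + 1 = 2 then (1 : L) else 0) w.1))) : GL (Fin 2) (w.1.adicCompletion L)) = (((localNonsplitEquiv (IsCMField.complexConj L) (Matrix.of fun i j : Fin 2 => if i.val + j.val + 1 = 2 then (1 : L) else 0) (IsCMField.complexConj_ne_one L) w hw) γ₂ : ↥(unitaryGroupOfForm (galAdicCompletionMap (L := L) (IsCMField.complexConj L) hw) (placeForm (Matrix.of fun i j : Fin 2 => if i.val + j.val + 1 = 2 then (1 : L) else 0)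 w.1))) : GL (Fin 2) (w.1.adicCompletion L)) * X₀ :=
    Units.ext (by rw [Units.val_mul, Units.val_mul]; exact hcomm)
  have hconjX : X₀⁻¹ * (((localNonsplitEquiv (IsCMField.complexConj L) (Matrix.of fun i j : Fin 2 => if i.val + j.val + 1 = 2 then (1 : L) else 0) (IsCMField.complexConj_ne_one L) w hw) γ₂ : ↥(unitaryGroupOfForm (galAdicCompletionMap (L := L) (IsCMField.complexConj L) hw) (placeForm (Matrix.of fun i j : Fin 2 => if i.val + j.val + 1 = 2 then (1 : L) else 0) w.1))) : GL (Fin 2) (w.1.adicCompletion L)) * X₀ = (((localNonsplitEquiv (IsCMField.complexConj L) (Matrix.of fun i j : Fin 2 => if i.val + j.val + 1 = 2 then (1 : L) else 0) (IsCMField.complexConj_ne_one L) w hw) γ₂ : ↥(unitaryGroupOfForm (galAdicCompletionMap (L := L) (IsCMField.complexConj L) hw) (placeForm (Matrix.of fun i j : Fin 2 => if i.val + j.val + 1 = 2 then (1 : L) else 0) w.1))) : GL (Fin 2) (w.1.adicCompletion L)) := by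
    rw [mul_assoc, ← hcommGL, inv_mul_cancel_left]
  -- the bijection `h ↦ X₀ h X₀⁻¹ k₀` of `U₂(L⁺_v) ≅ U`
  set k₀' : ↥(unitaryGroupOfForm (galAdicCompletionMap (L := L) (IsCMField.complexConj L) hw) (placeForm (Matrix.of fun i j : Fin 2 => if i.val + j.val + 1 = 2 then (1 : L) else 0) w.1)) := ⟨k₀, hk₀U⟩ with hk₀'
  set ΦU : ↥(unitaryGroupOfForm (galAdicCompletionMap (L := L) (IsCMField.complexConj L) hw) (placeForm (Matrix.of fun i j : Fin 2 => if i.val + j.val + 1 = 2 then (1 : L) else 0) w.1)) ≃ ↥(unitaryGroupOfForm (galAdicCompletionMap (L := L) (IsCMField.complexConj L) hw) (placeForm (Matrix.of fun i j : Fin 2 => if i.val + j.val + 1 = 2 then (1 : L) else 0) w.1)) :=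
    { toFun := fun h => ⟨X₀ * (h : GL (Fin 2) (w.1.adicCompletion L)) * X₀⁻¹, hnorm _ h.2⟩ * k₀'
      invFun := fun h' => ⟨X₀⁻¹ * ((h' * k₀'⁻¹ : ↥(unitaryGroupOfForm (galAdicCompletionMap (L := L) (IsCMField.complexConj L) hw) (placeForm (Matrix.of fun i j : Fin 2 => if i.val + j.val + 1 = 2 then (1 : L) else 0) w.1))) : GL (Fin 2) (w.1.adicCompletion L)) * X₀, hnorm' _ (h' * k₀'⁻¹).2⟩
      left_inv := fun h => by
        apply Subtype.ext
        simp only [Subgroup.coe_mul, Subgroup.coe_inv, hk₀']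
        group
      right_inv := fun h' => by
        apply Subtype.ext
        simp only [Subgroup.coe_mul, Subgroup.coe_inv, hk₀']
        group } with hΦU
  have hΦU_apply : ∀ h : ↥(unitaryGroupOfForm (galAdicCompletionMap (L := L) (IsCMField.complexConj L) hw) (placeForm (Matrix.of fun i j : Fin 2 => if i.val + j.val + 1 = 2 then (1 : L) else 0) w.1)), ((ΦU h : ↥(unitaryGroupOfForm (galAdicCompletionMap (L := L) (IsCMField.complexConj L) hw) (placeForm (Matrix.of fun i j : Fin 2 => if i.val + j.val + 1 = 2 then (1 : L) else 0) w.1))) : GL (Fin 2) (w.1.adicCompletion L)) = X₀ * (h : GL (Fin 2) (w.1.adicCompletion L)) * X₀⁻¹ * k₀ := fun h => rfl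
  set Φ : ((cmDatum L 2 (Matrix.of fun i j : Fin 2 => if i.val + j.val + 1 = 2 then (1 : L) else 0)).Local v) ≃ ((cmDatum L 2 (Matrix.of fun i j : Fin 2 => if i.val + j.val + 1 = 2 then (1 : L) else 0)).Local v) :=
    { toFun := fun g => ((localNonsplitEquiv (IsCMField.complexConj L) (Matrix.of fun i j : Fin 2 => if i.val + j.val + 1 = 2 then (1 : L) else 0) (IsCMField.complexConj_ne_one L) w hw)).symm (ΦU ((localNonsplitEquiv (IsCMField.complexConj L) (Matrix.of fun i j : Fin 2 => if i.val + j.val + 1 = 2 then (1 : L) else 0) (IsCMField.complexConj_ne_one L) w hw) g))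
      invFun := fun g => ((localNonsplitEquiv (IsCMField.complexConj L) (Matrix.of fun i j : Fin 2 => if i.val + j.val + 1 = 2 then (1 : L) else 0) (IsCMField.complexConj_ne_one L) w hw)).symm (ΦU.symm ((localNonsplitEquiv (IsCMField.complexConj L) (Matrix.of fun i j : Fin 2 => if i.val + j.val + 1 = 2 then (1 : L) else 0) (IsCMField.complexConj_ne_one L) w hw) g))
      left_inv := fun g => by simp only [ContinuousMulEquiv.apply_symm_apply, Equiv.symm_apply_apply]; exact ((localNonsplitEquiv (IsCMField.complexConj L) (Matrix.of fun i j : Fin 2 => if i.val + j.val + 1 = 2 then (1 : L) else 0) (IsCMField.complexConj_ne_one L) w hw)).symm_apply_apply g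
      right_inv := fun g => by simp only [ContinuousMulEquiv.apply_symm_apply, Equiv.apply_symm_apply]; exact ((localNonsplitEquiv (IsCMField.complexConj L) (Matrix.of fun i j : Fin 2 => if i.val + j.val + 1 = 2 then (1 : L) else 0) (IsCMField.complexConj_ne_one L) w hw)).symm_apply_apply g } with hΦ
  have hEΦ : ∀ g : ((cmDatum L 2 (Matrix.of fun i j : Fin 2 => if i.val + j.val + 1 = 2 then (1 : L) else 0)).Local v), (localNonsplitEquiv (IsCMField.complexConj L) (Matrix.of fun i j : Fin 2 => if i.val + j.val + 1 = 2 then (1 : L) else 0) (IsCMField.complexConj_ne_one L) w hw) (Φ g) = ΦU ((localNonsplitEquiv (IsCMField.complexConj L) (Matrix.of fun i j : Fin 2 => if i.val + j.val + 1 = 2 then (1 : L) else 0) (IsCMField.complexConj_ne_one L) w hw) g) := fun g => ((localNonsplitEquiv (IsCMField.complexConj L) (Matrix.of fun i j : Fin 2 => if i.val + j.val + 1 = 2 then (1 : L) else 0) (IsCMField.complexConj_ne_one L) w hw)).apply_symm_apply _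
  -- `E₂` on conjugates, at the `GL₂` level
  have hEconj : ∀ a b : ((cmDatum L 2 (Matrix.of fun i j : Fin 2 => if i.val + j.val + 1 = 2 then (1 : L) else 0)).Local v), (((localNonsplitEquiv (IsCMField.complexConj L) (Matrix.of fun i j : Fin 2 => if i.val + j.val + 1 = 2 then (1 : L) else 0) (IsCMField.complexConj_ne_one L) w hw) (a⁻¹ * b) : ↥(unitaryGroupOfForm (galAdicCompletionMap (L := L) (IsCMField.complexConj L) hw) (placeForm (Matrix.of fun i j : Fin 2 => if i.val + j.val + 1 = 2 then (1 : L) else 0) w.1))) : GL (Fin 2) (w.1.adicCompletion L)) = ((((localNonsplitEquiv (IsCMField.complexConj L) (Matrix.of fun i j : Fin 2 => if i.val + j.val + 1 = 2 then (1 : L) else 0) (IsCMField.complexConj_ne_one L) w hw) a : ↥(unitaryGroupOfForm (galAdicCompletionMap (L := L) (IsCMField.complexConj L) hw) (placeForm (Matrix.of fun i j : Fin 2 => if i.val + j.val + 1 = 2 then (1 : L) else 0) w.1))) : GL (Fin 2) (w.1.adicCompletion L)))⁻¹ * (((localNonsplitEquiv (IsCMField.complexConj L) (Matrix.of fun i j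 : Fin 2 => if i.val + j.val + 1 = 2 then (1 : L) else 0) (IsCMField.complexConj_ne_one L) w hw) b : ↥(unitaryGroupOfForm (galAdicCompletionMap (L := L) (IsCMField.complexConj L) hw) (placeForm (Matrix.of fun i j : Fin 2 => if i.val + j.val + 1 = 2 then (1 : L) else 0) w.1))) : GL (Fin 2) (w.1.adicCompletion L)) := by
    intro a b
    have h1 := map_mul ((localNonsplitEquiv (IsCMField.complexConj L) (Matrix.of fun i j : Fin 2 => if i.val + j.val + 1 = 2 then (1 : L) else 0) (IsCMField.complexConj_ne_one L) w hw)) a⁻¹ b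
    have h3 := map_inv ((localNonsplitEquiv (IsCMField.complexConj L) (Matrix.of fun i j : Fin 2 => if i.val + j.val + 1 = 2 then (1 : L) else 0) (IsCMField.complexConj_ne_one L) w hw)) a
    rw [h3] at h1
    have h4 := congrArg (fun z : ↥(unitaryGroupOfForm (galAdicCompletionMap (L := L) (IsCMField.complexConj L) hw) (placeForm (Matrix.of fun i j : Fin 2 => if i.val + j.val + 1 = 2 then (1 : L) else 0) w.1)) => (z : GL (Fin 2) (w.1.adicCompletion L))) h1
    simp only [Subgroup.coe_mul, Subgroup.coe_inv] at h4
    exact h4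
  have hEconj3 : ∀ x y : ((cmDatum L 2 (Matrix.of fun i j : Fin 2 => if i.val + j.val + 1 = 2 then (1 : L) else 0)).Local v), (((localNonsplitEquiv (IsCMField.complexConj L) (Matrix.of fun i j : Fin 2 => if i.val + j.val + 1 = 2 then (1 : L) else 0) (IsCMField.complexConj_ne_one L) w hw) (y⁻¹ * x * y) : ↥(unitaryGroupOfForm (galAdicCompletionMap (L := L) (IsCMField.complexConj L) hw) (placeForm (Matrix.of fun i j : Fin 2 => if i.val + j.val + 1 = 2 then (1 : L) else 0) w.1))) : GL (Fin 2) (w.1.adicCompletion L)) =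
      ((((localNonsplitEquiv (IsCMField.complexConj L) (Matrix.of fun i j : Fin 2 => if i.val + j.val + 1 = 2 then (1 : L) else 0) (IsCMField.complexConj_ne_one L) w hw) y : ↥(unitaryGroupOfForm (galAdicCompletionMap (L := L) (IsCMField.complexConj L) hw) (placeForm (Matrix.of fun i j : Fin 2 => if i.val + j.val + 1 = 2 then (1 : L) else 0) w.1))) : GL (Fin 2) (w.1.adicCompletion L)))⁻¹ * (((localNonsplitEquiv (IsCMField.complexConj L) (Matrix.of fun i j : Fin 2 => if i.val + j.val + 1 = 2 then (1 : L) else 0) (IsCMField.complexConj_ne_one L) w hw) x : ↥(unitaryGroupOfForm (galAdicCompletionMap (L := L) (IsCMField.complexConj L) hw) (placeForm (Matrix.of fun i j : Fin 2 => if i.val + j.val + 1 = 2 then (1 : L) else 0) w.1))) : GL (Fin 2) (w.1.adicCompletion L)) * (((localNonsplitEquiv (IsCMField.complexConj L) (Matrix.of fun i j : Fin 2 => if i.val + j.val + 1 = 2 then (1 : L) else 0) (IsCMField.complexConj_ne_one L) w hw) y : ↥(unitaryGroupOfForm (galAdicCompletionMap (L := L) (IsCMField.complexConj L) hw) (placeForm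 (Matrix.of fun i j : Fin 2 => if i.val + j.val + 1 = 2 then (1 : L) else 0) w.1))) : GL (Fin 2) (w.1.adicCompletion L)) := by
    intro x y
    have h1 := map_mul ((localNonsplitEquiv (IsCMField.complexConj L) (Matrix.of fun i j : Fin 2 => if i.val + j.val + 1 = 2 then (1 : L) else 0) (IsCMField.complexConj_ne_one L) w hw)) (y⁻¹ * x) y
    have h2 := map_mul ((localNonsplitEquiv (IsCMField.complexConj L) (Matrix.of fun i j : Fin 2 => if i.val + j.val + 1 = 2 then (1 : L) else 0) (IsCMField.complexConj_ne_one L) w hw)) y⁻¹ x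
    have h3 := map_inv ((localNonsplitEquiv (IsCMField.complexConj L) (Matrix.of fun i j : Fin 2 => if i.val + j.val + 1 = 2 then (1 : L) else 0) (IsCMField.complexConj_ne_one L) w hw)) y
    rw [h2, h3] at h1
    have h4 := congrArg (fun z : ↥(unitaryGroupOfForm (galAdicCompletionMap (L := L) (IsCMField.complexConj L) hw) (placeForm (Matrix.of fun i j : Fin 2 => if i.val + j.val + 1 = 2 then (1 : L) else 0) w.1)) => (z : GL (Fin 2) (w.1.adicCompletion L))) h1
    simp only [Subgroup.coe_mul, Subgroup.coe_inv] at h4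
    exact h4
  -- `P := k₀⁻¹ X₀ ∈ GL₂(𝒪_w)`: an INTEGRAL similitude of multiplier `ι(ν)`
  have hPsim : ((((k₀⁻¹ * X₀ : GL (Fin 2) (w.1.adicCompletion L))) : Matrix (Fin 2) (Fin 2) (w.1.adicCompletion L)).map (galAdicCompletionMap (L := L) (IsCMField.complexConj L) hw))ᵀ * !![(0 : (w.1.adicCompletion L)), 1; 1, 0] * ((k₀⁻¹ * X₀ : GL (Fin 2) (w.1.adicCompletion L)) : Matrix (Fin 2) (Fin 2) (w.1.adicCompletion L)) =
      toPlace v w ν • !![(0 : (w.1.adicCompletion L)), 1; 1, 0] := by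
    have hk := mem_unitaryGroupOfForm_iff.1 (inv_mem hk₀J)
    rw [Units.val_mul, Matrix.map_mul, Matrix.transpose_mul]
    calc ((X₀ : Matrix (Fin 2) (Fin 2) (w.1.adicCompletion L)).map (galAdicCompletionMap (L := L) (IsCMField.complexConj L) hw))ᵀ * (((k₀⁻¹ : GL (Fin 2) (w.1.adicCompletion L)) : Matrix (Fin 2) (Fin 2) (w.1.adicCompletion L)).map (galAdicCompletionMap (L := L) (IsCMField.complexConj L) hw))ᵀ * !![(0 : (w.1.adicCompletion L)), 1; 1, 0] *
          (((k₀⁻¹ : GL (Fin 2) (w.1.adicCompletion L)) : Matrix (Fin 2) (Fin 2) (w.1.adicCompletion L)) * (X₀ : Matrix (Fin 2) (Fin 2) (w.1.adicCompletion L)))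
        = ((X₀ : Matrix (Fin 2) (Fin 2) (w.1.adicCompletion L)).map (galAdicCompletionMap (L := L) (IsCMField.complexConj L) hw))ᵀ * ((((k₀⁻¹ : GL (Fin 2) (w.1.adicCompletion L)) : Matrix (Fin 2) (Fin 2) (w.1.adicCompletion L)).map (galAdicCompletionMap (L := L) (IsCMField.complexConj L) hw))ᵀ * !![(0 : (w.1.adicCompletion L)), 1; 1, 0] *
            ((k₀⁻¹ : GL (Fin 2) (w.1.adicCompletion L)) : Matrix (Fin 2) (Fin 2) (w.1.adicCompletion L))) * (X₀ : Matrix (Fin 2) (Fin 2) (w.1.adicCompletion L)) := by simp only [Matrix.mul_assoc]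
      _ = _ := by rw [hk, hsim]
  have hPP' : ((k₀⁻¹ * X₀ : GL (Fin 2) (w.1.adicCompletion L)) : Matrix (Fin 2) (Fin 2) (w.1.adicCompletion L)) * (((k₀⁻¹ * X₀)⁻¹ : GL (Fin 2) (w.1.adicCompletion L)) : Matrix (Fin 2) (Fin 2) (w.1.adicCompletion L)) = 1 := by
    rw [← Units.val_mul, mul_inv_cancel, Units.val_one]
  have hP'P : (((k₀⁻¹ * X₀)⁻¹ : GL (Fin 2) (w.1.adicCompletion L)) : Matrix (Fin 2) (Fin 2) (w.1.adicCompletion L)) * ((k₀⁻¹ * X₀ : GL (Fin 2) (w.1.adicCompletion L)) : Matrix (Fin 2) (Fin 2) (w.1.adicCompletion L)) = 1 := by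
    rw [← Units.val_mul, inv_mul_cancel, Units.val_one]
  have hPi := ((mem_glInt_iff_forall_v_le_one_and_v_det_eq_one (k₀⁻¹ * X₀)).1 hPint).1
  have hP'i := ((mem_glInt_iff_forall_v_le_one_and_v_det_eq_one ((k₀⁻¹ * X₀)⁻¹)).1 (inv_mem hPint)).1
  have hcν : Valued.v (c₀ - toPlace v w ν * c₁) < 1 := by
    rw [show c₀ - toPlace v w ν * c₁ = -(c₁ * (toPlace v w ν - c₀ * c₁⁻¹)) by field_simp; ring, Valuation.map_neg, map_mul, hc₁, one_mul]
    exact hνc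
  -- `K⁰`-membership through `E₂`
  have hK0 : ∀ y : ((cmDatum L 2 (Matrix.of fun i j : Fin 2 => if i.val + j.val + 1 = 2 then (1 : L) else 0)).Local v), y ∈ (cmLocalIntegralLevel L 2 (Matrix.of fun i j : Fin 2 => if i.val + j.val + 1 = 2 then (1 : L) else 0) v) ↔ (((localNonsplitEquiv (IsCMField.complexConj L) (Matrix.of fun i j : Fin 2 => if i.val + j.val + 1 = 2 then (1 : L) else 0) (IsCMField.complexConj_ne_one L) w hw) y : ↥(unitaryGroupOfForm (galAdicCompletionMap (L := L) (IsCMField.complexConj L) hw) (placeForm (Matrix.of fun i j : Fin 2 => if i.val + j.val + 1 = 2 then (1 : L) else 0) w.1))) : GL (Fin 2) (w.1.adicCompletion L)) ∈ glInt 2 (w.1.adicCompletion L) :=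
    fun y => mem_localIntegralLevel_iff_of_smul_eq (IsCMField.complexConj L) 2 (Matrix.of fun i j : Fin 2 => if i.val + j.val + 1 = 2 then (1 : L) else 0) (IsCMField.complexConj_ne_one L) w hw y
  -- coset compatibility in both directions: `E₂((Φg₁)⁻¹ Φg₂) = P · E₂(g₁⁻¹g₂) · P⁻¹`
  have hΦK : ∀ g₁ g₂ : ((cmDatum L 2 (Matrix.of fun i j : Fin 2 => if i.val + j.val + 1 = 2 then (1 : L) else 0)).Local v), g₁⁻¹ * g₂ ∈ (cmLocalIntegralLevel L 2 (Matrix.of fun i j : Fin 2 => if i.val + j.val + 1 = 2 then (1 : L) else 0) v) ↔ (Φ g₁)⁻¹ * Φ g₂ ∈ (cmLocalIntegralLevel L 2 (Matrix.of fun i j : Fin 2 => if i.val + j.val + 1 = 2 then (1 : L) else 0) v) := by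
    intro g₁ g₂
    rw [hK0, hK0, hEconj, hEconj, hEΦ, hEΦ, hΦU_apply, hΦU_apply]
    rw [show (X₀ * (((localNonsplitEquiv (IsCMField.complexConj L) (Matrix.of fun i j : Fin 2 => if i.val + j.val + 1 = 2 then (1 : L) else 0) (IsCMField.complexConj_ne_one L) w hw) g₁ : ↥(unitaryGroupOfForm (galAdicCompletionMap (L := L) (IsCMField.complexConj L) hw) (placeForm (Matrix.of fun i j : Fin 2 => if i.val + j.val + 1 = 2 then (1 : L) else 0) w.1))) : GL (Fin 2) (w.1.adicCompletion L)) * X₀⁻¹ * k₀)⁻¹ * (X₀ * (((localNonsplitEquiv (IsCMField.complexConj L) (Matrix.of fun i j : Fin 2 => if i.val + j.val + 1 = 2 then (1 : L) else 0) (IsCMField.complexConj_ne_one L) w hw) g₂ : ↥(unitaryGroupOfForm (galAdicCompletionMap (L := L) (IsCMField.complexConj L) hw) (placeForm (Matrix.of fun i j : Fin 2 => if i.val + j.val + 1 = 2 then (1 : L) else 0) w.1))) : GL (Fin 2) (w.1.adicCompletion L)) * X₀⁻¹ * k₀) =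
        (k₀⁻¹ * X₀) * (((((localNonsplitEquiv (IsCMField.complexConj L) (Matrix.of fun i j : Fin 2 => if i.val + j.val + 1 = 2 then (1 : L) else 0) (IsCMField.complexConj_ne_one L) w hw) g₁ : ↥(unitaryGroupOfForm (galAdicCompletionMap (L := L) (IsCMField.complexConj L) hw) (placeForm (Matrix.of fun i j : Fin 2 => if i.val + j.val + 1 = 2 then (1 : L) else 0) w.1))) : GL (Fin 2) (w.1.adicCompletion L)))⁻¹ * (((localNonsplitEquiv (IsCMField.complexConj L) (Matrix.of fun i j : Fin 2 => if i.val + j.val + 1 = 2 then (1 : L) else 0) (IsCMField.complexConj_ne_one L) w hw) g₂ : ↥(unitaryGroupOfForm (galAdicCompletionMap (L := L) (IsCMField.complexConj L) hw) (placeForm (Matrix.of fun i j : Fin 2 => if i.val + j.val + 1 = 2 then (1 : L) else 0) w.1))) : GL (Fin 2) (w.1.adicCompletion L))) * (k₀⁻¹ * X₀)⁻¹ by group,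
      Subgroup.mul_mem_cancel_right _ (inv_mem hPint), Subgroup.mul_mem_cancel_left _ hPint]
  -- the monodromy at `Φ g` is the `P`-conjugate of the monodromy at `g`
  have hmono : ∀ g' : ((cmDatum L 2 (Matrix.of fun i j : Fin 2 => if i.val + j.val + 1 = 2 then (1 : L) else 0)).Local v), ((((localNonsplitEquiv (IsCMField.complexConj L) (Matrix.of fun i j : Fin 2 => if i.val + j.val + 1 = 2 then (1 : L) else 0) (IsCMField.complexConj_ne_one L) w hw) ((Φ g')⁻¹ * γ₂ * Φ g') : ↥(unitaryGroupOfForm (galAdicCompletionMap (L := L) (IsCMField.complexConj L) hw) (placeForm (Matrix.of fun i j : Fin 2 => if i.val + j.val + 1 = 2 then (1 : L) else 0) w.1))) : GL (Fin 2) (w.1.adicCompletion L)) : Matrix (Fin 2) (Fin 2) (w.1.adicCompletion L)) =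
      ((k₀⁻¹ * X₀ : GL (Fin 2) (w.1.adicCompletion L)) : Matrix (Fin 2) (Fin 2) (w.1.adicCompletion L)) * ((((localNonsplitEquiv (IsCMField.complexConj L) (Matrix.of fun i j : Fin 2 => if i.val + j.val + 1 = 2 then (1 : L) else 0) (IsCMField.complexConj_ne_one L) w hw) (g'⁻¹ * γ₂ * g') : ↥(unitaryGroupOfForm (galAdicCompletionMap (L := L) (IsCMField.complexConj L) hw) (placeForm (Matrix.of fun i j : Fin 2 => if i.val + j.val + 1 = 2 then (1 : L) else 0) w.1))) : GL (Fin 2) (w.1.adicCompletion L)) : Matrix (Fin 2) (Fin 2) (w.1.adicCompletion L)) * (((k₀⁻¹ * X₀)⁻¹ : GL (Fin 2) (w.1.adicCompletion L)) : Matrix (Fin 2) (Fin 2) (w.1.adicCompletion L)) := by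
    intro g'
    have h1 : (((localNonsplitEquiv (IsCMField.complexConj L) (Matrix.of fun i j : Fin 2 => if i.val + j.val + 1 = 2 then (1 : L) else 0) (IsCMField.complexConj_ne_one L) w hw) ((Φ g')⁻¹ * γ₂ * Φ g') : ↥(unitaryGroupOfForm (galAdicCompletionMap (L := L) (IsCMField.complexConj L) hw) (placeForm (Matrix.of fun i j : Fin 2 => if i.val + j.val + 1 = 2 then (1 : L) else 0) w.1))) : GL (Fin 2) (w.1.adicCompletion L)) =
        (k₀⁻¹ * X₀) * (((localNonsplitEquiv (IsCMField.complexConj L) (Matrix.of fun i j : Fin 2 => if i.val + j.val + 1 = 2 then (1 : L) else 0) (IsCMField.complexConj_ne_one L) w hw) (g'⁻¹ * γ₂ * g') : ↥(unitaryGroupOfForm (galAdicCompletionMap (L := L) (IsCMField.complexConj L) hw) (placeForm (Matrix.of fun i j : Fin 2 => if i.val + j.val + 1 = 2 then (1 : L) else 0) w.1))) : GL (Fin 2) (w.1.adicCompletion L)) * (k₀⁻¹ * X₀)⁻¹ := by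
      rw [hEconj3, hEconj3, hEΦ, hΦU_apply]
      calc (X₀ * (((localNonsplitEquiv (IsCMField.complexConj L) (Matrix.of fun i j : Fin 2 => if i.val + j.val + 1 = 2 then (1 : L) else 0) (IsCMField.complexConj_ne_one L) w hw) g' : ↥(unitaryGroupOfForm (galAdicCompletionMap (L := L) (IsCMField.complexConj L) hw) (placeForm (Matrix.of fun i j : Fin 2 => if i.val + j.val + 1 = 2 then (1 : L) else 0) w.1))) : GL (Fin 2) (w.1.adicCompletion L)) * X₀⁻¹ * k₀)⁻¹ * (((localNonsplitEquiv (IsCMField.complexConj L) (Matrix.of fun i j : Fin 2 => if i.val + j.val + 1 = 2 then (1 : L) else 0) (IsCMField.complexConj_ne_one L) w hw) γ₂ : ↥(unitaryGroupOfForm (galAdicCompletionMap (L := L) (IsCMField.complexConj L) hw) (placeForm (Matrix.of fun i j : Fin 2 => if i.val + j.val + 1 = 2 then (1 : L) else 0) w.1))) : GL (Fin 2) (w.1.adicCompletion L)) * (X₀ * (((localNonsplitEquiv (IsCMField.complexConj L) (Matrix.of fun i j : Fin 2 => if i.val + j.val + 1 = 2 then (1 : L) else 0) (IsCMField.complexConj_ne_one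 L) w hw) g' : ↥(unitaryGroupOfForm (galAdicCompletionMap (L := L) (IsCMField.complexConj L) hw) (placeForm (Matrix.of fun i j : Fin 2 => if i.val + j.val + 1 = 2 then (1 : L) else 0) w.1))) : GL (Fin 2) (w.1.adicCompletion L)) * X₀⁻¹ * k₀)
          = (k₀⁻¹ * X₀) * (((((localNonsplitEquiv (IsCMField.complexConj L) (Matrix.of fun i j : Fin 2 => if i.val + j.val + 1 = 2 then (1 : L) else 0) (IsCMField.complexConj_ne_one L) w hw) g' : ↥(unitaryGroupOfForm (galAdicCompletionMap (L := L) (IsCMField.complexConj L) hw) (placeForm (Matrix.of fun i j : Fin 2 => if i.val + j.val + 1 = 2 then (1 : L) else 0) w.1))) : GL (Fin 2) (w.1.adicCompletion L)))⁻¹ * (X₀⁻¹ * (((localNonsplitEquiv (IsCMField.complexConj L) (Matrix.of fun i j : Fin 2 => if i.val + j.val + 1 = 2 then (1 : L) else 0) (IsCMField.complexConj_ne_one L) w hw) γ₂ : ↥(unitaryGroupOfForm (galAdicCompletionMap (L := L) (IsCMField.complexConj L) hw) (placeForm (Matrix.of fun i j : Fin 2 => if i.val + j.val + 1 = 2 then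 (1 : L) else 0) w.1))) : GL (Fin 2) (w.1.adicCompletion L)) * X₀) * (((localNonsplitEquiv (IsCMField.complexConj L) (Matrix.of fun i j : Fin 2 => if i.val + j.val + 1 = 2 then (1 : L) else 0) (IsCMField.complexConj_ne_one L) w hw) g' : ↥(unitaryGroupOfForm (galAdicCompletionMap (L := L) (IsCMField.complexConj L) hw) (placeForm (Matrix.of fun i j : Fin 2 => if i.val + j.val + 1 = 2 then (1 : L) else 0) w.1))) : GL (Fin 2) (w.1.adicCompletion L))) * (k₀⁻¹ * X₀)⁻¹ := by group
        _ = _ := by rw [hconjX]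
    have h2 := congrArg (fun z : GL (Fin 2) (w.1.adicCompletion L) => (z : Matrix (Fin 2) (Fin 2) (w.1.adicCompletion L))) h1
    simp only [Units.val_mul] at h2
    exact h2
  -- stability of `S` in both directions
  have hSiff : ∀ Y : Matrix (Fin 2) (Fin 2) (w.1.adicCompletion L), S (((k₀⁻¹ * X₀ : GL (Fin 2) (w.1.adicCompletion L)) : Matrix (Fin 2) (Fin 2) (w.1.adicCompletion L)) * Y * (((k₀⁻¹ * X₀)⁻¹ : GL (Fin 2) (w.1.adicCompletion L)) : Matrix (Fin 2) (Fin 2) (w.1.adicCompletion L))) ↔ S Y := by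
    intro Y
    refine ⟨fun h => ?_, hS _ hPint Y⟩
    have h' := hS _ (inv_mem hPint) _ h
    have e : (((k₀⁻¹ * X₀)⁻¹ : GL (Fin 2) (w.1.adicCompletion L)) : Matrix (Fin 2) (Fin 2) (w.1.adicCompletion L)) * ((((k₀⁻¹ * X₀ : GL (Fin 2) (w.1.adicCompletion L)) : Matrix (Fin 2) (Fin 2) (w.1.adicCompletion L)) * Y * (((k₀⁻¹ * X₀)⁻¹ : GL (Fin 2) (w.1.adicCompletion L)) : Matrix (Fin 2) (Fin 2) (w.1.adicCompletion L)))) *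
        ((((k₀⁻¹ * X₀)⁻¹)⁻¹ : GL (Fin 2) (w.1.adicCompletion L)) : Matrix (Fin 2) (Fin 2) (w.1.adicCompletion L)) = Y := by
      rw [inv_inv]
      calc (((k₀⁻¹ * X₀)⁻¹ : GL (Fin 2) (w.1.adicCompletion L)) : Matrix (Fin 2) (Fin 2) (w.1.adicCompletion L)) * ((((k₀⁻¹ * X₀ : GL (Fin 2) (w.1.adicCompletion L)) : Matrix (Fin 2) (Fin 2) (w.1.adicCompletion L)) * Y * (((k₀⁻¹ * X₀)⁻¹ : GL (Fin 2) (w.1.adicCompletion L)) : Matrix (Fin 2) (Fin 2) (w.1.adicCompletion L)))) * ((k₀⁻¹ * X₀ : GL (Fin 2) (w.1.adicCompletion L)) : Matrix (Fin 2) (Fin 2) (w.1.adicCompletion L))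
          = ((((k₀⁻¹ * X₀)⁻¹ : GL (Fin 2) (w.1.adicCompletion L)) : Matrix (Fin 2) (Fin 2) (w.1.adicCompletion L)) * ((k₀⁻¹ * X₀ : GL (Fin 2) (w.1.adicCompletion L)) : Matrix (Fin 2) (Fin 2) (w.1.adicCompletion L))) * Y *
              ((((k₀⁻¹ * X₀)⁻¹ : GL (Fin 2) (w.1.adicCompletion L)) : Matrix (Fin 2) (Fin 2) (w.1.adicCompletion L)) * ((k₀⁻¹ * X₀ : GL (Fin 2) (w.1.adicCompletion L)) : Matrix (Fin 2) (Fin 2) (w.1.adicCompletion L))) := by simp only [Matrix.mul_assoc]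
        _ = Y := by rw [hP'P, Matrix.one_mul, Matrix.mul_one]
    rwa [e] at h'
  -- assemble: transport of coset counts along `Φ`
  refine (natCard_setOf_exists_mk_eq_of_equiv ((cmLocalIntegralLevel L 2 (Matrix.of fun i j : Fin 2 => if i.val + j.val + 1 = 2 then (1 : L) else 0) v)) Φ hΦK
    (fun h : ((cmDatum L 2 (Matrix.of fun i j : Fin 2 => if i.val + j.val + 1 = 2 then (1 : L) else 0)).Local v) => S (((((localNonsplitEquiv (IsCMField.complexConj L) (Matrix.of fun i j : Fin 2 => if i.val + j.val + 1 = 2 then (1 : L) else 0) (IsCMField.complexConj_ne_one L) w hw) (h⁻¹ * γ₂ * h) : ↥(unitaryGroupOfForm (galAdicCompletionMap (L := L) (IsCMField.complexConj L) hw) (placeForm (Matrix.of fun i j : Fin 2 => if i.val + j.val + 1 = 2 then (1 : L) else 0) w.1))) : GL (Fin 2) (w.1.adicCompletion L)) : Matrix (Fin 2) (Fin 2) (w.1.adicCompletion L))) ∧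
      ∃ (y : Fin 2 → (w.1.adicCompletion L)) (a : (w.1.adicCompletion L)), (∀ i, Valued.v (y i) ≤ 1) ∧ Valued.v a = 1 ∧
        Valued.v (ϖ₁ * ((fun i => (galAdicCompletionMap (L := L) (IsCMField.complexConj L) hw) (y i)) ⬝ᵥ (!![(0 : (w.1.adicCompletion L)), 1; 1, 0] *ᵥ ((((((localNonsplitEquiv (IsCMField.complexConj L) (Matrix.of fun i j : Fin 2 => if i.val + j.val + 1 = 2 then (1 : L) else 0) (IsCMField.complexConj_ne_one L) w hw) (h⁻¹ * γ₂ * h) : ↥(unitaryGroupOfForm (galAdicCompletionMap (L := L) (IsCMField.complexConj L) hw) (placeForm (Matrix.of fun i j : Fin 2 => if i.val + j.val + 1 = 2 then (1 : L) else 0) w.1))) : GL (Fin 2) (w.1.adicCompletion L)) : Matrix (Fin 2) (Fin 2) (w.1.adicCompletion L)) - c • (1 : Matrix (Fin 2) (Fin 2) (w.1.adicCompletion L))) *ᵥ y))) - c₁ * a ^ 2) < 1)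
    (fun h : ((cmDatum L 2 (Matrix.of fun i j : Fin 2 => if i.val + j.val + 1 = 2 then (1 : L) else 0)).Local v) => S (((((localNonsplitEquiv (IsCMField.complexConj L) (Matrix.of fun i j : Fin 2 => if i.val + j.val + 1 = 2 then (1 : L) else 0) (IsCMField.complexConj_ne_one L) w hw) (h⁻¹ * γ₂ * h) : ↥(unitaryGroupOfForm (galAdicCompletionMap (L := L) (IsCMField.complexConj L) hw) (placeForm (Matrix.of fun i j : Fin 2 => if i.val + j.val + 1 = 2 then (1 : L) else 0) w.1))) : GL (Fin 2) (w.1.adicCompletion L)) : Matrix (Fin 2) (Fin 2) (w.1.adicCompletion L))) ∧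
      ∃ (y : Fin 2 → (w.1.adicCompletion L)) (a : (w.1.adicCompletion L)), (∀ i, Valued.v (y i) ≤ 1) ∧ Valued.v a = 1 ∧
        Valued.v (ϖ₁ * ((fun i => (galAdicCompletionMap (L := L) (IsCMField.complexConj L) hw) (y i)) ⬝ᵥ (!![(0 : (w.1.adicCompletion L)), 1; 1, 0] *ᵥ ((((((localNonsplitEquiv (IsCMField.complexConj L) (Matrix.of fun i j : Fin 2 => if i.val + j.val + 1 = 2 then (1 : L) else 0) (IsCMField.complexConj_ne_one L) w hw) (h⁻¹ * γ₂ * h) : ↥(unitaryGroupOfForm (galAdicCompletionMap (L := L) (IsCMField.complexConj L) hw) (placeForm (Matrix.of fun i j : Fin 2 => if i.val + j.val + 1 = 2 then (1 : L) else 0) w.1))) : GL (Fin 2) (w.1.adicCompletion L)) : Matrix (Fin 2) (Fin 2) (w.1.adicCompletion L)) - c • (1 : Matrix (Fin 2) (Fin 2) (w.1.adicCompletion L))) *ᵥ y))) - c₀ * a ^ 2) < 1)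
    fun g' => ?_).symm
  simp only [hmono g']
  exact and_congr (hSiff _) (exists_class_conj_iff w.1 (galAdicCompletionMap (L := L) (IsCMField.complexConj L) hw) hPsim hιν hPP' hP'P hPi hP'i hcν ϖ₁ _ _)

end FlipLawScalar

/-! ## §2 Even and odd depth, free centring scalar -/

section ParityScalar

variable (L : Type) [Field L] [NumberField L] [IsCMField L] (v : HeightOneSpectrum (𝓞 ↥(maximalRealSubfield L)))
  (w : PlacesOver L v) (hw : IsCMField.complexConj L • w.1 = w.1)

set_option maxHeartbeats 1600000 in
include hw in
/-- **THE CLASS LAW AT EVEN DEPTH, FREE CENTRING SCALAR** (★ 2b `natCard_class_eq_natCard_class_of_even_depth_ramified` with `c` free; flip = ★ 2a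
`exists_classFlip_similitude_of_unit`). [cite: LabesseLanglands1979, §2 pp. 7–8] [cite: Rogawski1990, §4.9 p. 55] -/
theorem natCard_class_eq_natCard_class_of_even_depth_ramified_scalar (he : v.asIdeal.ramificationIdx' w.1.asIdeal ≠ 1) (h2 : IsUnit (2 : 𝒪[(w.1.adicCompletion L)]))
    (ϖ : (w.1.adicCompletion L)ˣ) (hϖ : Valued.v (ϖ : (w.1.adicCompletion L)) = WithZero.exp (-1 : ℤ))
    (hσϖ : (galAdicCompletionMap (L := L) (IsCMField.complexConj L) hw) (ϖ : (w.1.adicCompletion L)) = -(ϖ : (w.1.adicCompletion L)))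
    (γ₂ : ((cmDatum L 2 (Matrix.of fun i j : Fin 2 => if i.val + j.val + 1 = 2 then (1 : L) else 0)).Local v))
    (hirr : ¬ ∃ x : (w.1.adicCompletion L), ((((((localNonsplitEquiv (IsCMField.complexConj L) (Matrix.of fun i j : Fin 2 => if i.val + j.val + 1 = 2 then (1 : L) else 0) (IsCMField.complexConj_ne_one L) w hw) (γ₂) : ↥(unitaryGroupOfForm (galAdicCompletionMap (L := L) (IsCMField.complexConj L) hw) (placeForm (Matrix.of fun i j : Fin 2 => if i.val + j.val + 1 = 2 then (1 : L) else 0) w.1))) : GL (Fin 2) (w.1.adicCompletion L)) : Matrix (Fin 2) (Fin 2) (w.1.adicCompletion L))).charpoly).IsRoot x)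
    {n : ℕ} (hn1 : 1 ≤ n) (hN : Valued.v ((((((localNonsplitEquiv (IsCMField.complexConj L) (Matrix.of fun i j : Fin 2 => if i.val + j.val + 1 = 2 then (1 : L) else 0) (IsCMField.complexConj_ne_one L) w hw) (γ₂) : ↥(unitaryGroupOfForm (galAdicCompletionMap (L := L) (IsCMField.complexConj L) hw) (placeForm (Matrix.of fun i j : Fin 2 => if i.val + j.val + 1 = 2 then (1 : L) else 0) w.1))) : GL (Fin 2) (w.1.adicCompletion L)) : Matrix (Fin 2) (Fin 2) (w.1.adicCompletion L))).trace ^ 2 - 4 * (((((localNonsplitEquiv (IsCMField.complexConj L) (Matrix.of fun i j : Fin 2 => if i.val + j.val + 1 = 2 then (1 : L) else 0) (IsCMField.complexConj_ne_one L) w hw) (γ₂) : ↥(unitaryGroupOfForm (galAdicCompletionMap (L := L) (IsCMField.complexConj L) hw) (placeForm (Matrix.of fun i j : Fin 2 => if i.val + j.val + 1 = 2 then (1 : L) else 0) w.1))) : GL (Fin 2) (w.1.adicCompletion L)) : Matrix (Fin 2) (Fin 2) (w.1.adicCompletion L))).det) = WithZero.exp (-((2 * (2 * n) : ℕ) : 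ℤ)))
    (S : Matrix (Fin 2) (Fin 2) (w.1.adicCompletion L) → Prop) (hS : ∀ P : GL (Fin 2) (w.1.adicCompletion L), P ∈ glInt 2 (w.1.adicCompletion L) → ∀ Y : Matrix (Fin 2) (Fin 2) (w.1.adicCompletion L), S Y → S ((P : Matrix (Fin 2) (Fin 2) (w.1.adicCompletion L)) * Y * ((P⁻¹ : GL (Fin 2) (w.1.adicCompletion L)) : Matrix (Fin 2) (Fin 2) (w.1.adicCompletion L))))
    (ϖ₁ c : (w.1.adicCompletion L)) {c₀ c₁ : (w.1.adicCompletion L)} (hc₀ : Valued.v c₀ = 1) (hc₁ : Valued.v c₁ = 1) :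
    Nat.card {x : ((cmDatum L 2 (Matrix.of fun i j : Fin 2 => if i.val + j.val + 1 = 2 then (1 : L) else 0)).Local v) ⧸ (cmLocalIntegralLevel L 2 (Matrix.of fun i j : Fin 2 => if i.val + j.val + 1 = 2 then (1 : L) else 0) v) | ∃ h : ((cmDatum L 2 (Matrix.of fun i j : Fin 2 => if i.val + j.val + 1 = 2 then (1 : L) else 0)).Local v), x = (h : ((cmDatum L 2 (Matrix.of fun i j : Fin 2 => if i.val + j.val + 1 = 2 then (1 : L) else 0)).Local v) ⧸ (cmLocalIntegralLevel L 2 (Matrix.of fun i j : Fin 2 => if i.val + j.val + 1 = 2 then (1 : L) else 0) v)) ∧ S (((((localNonsplitEquiv (IsCMField.complexConj L) (Matrix.of fun i j : Fin 2 => if i.val + j.val + 1 = 2 then (1 : L) else 0) (IsCMField.complexConj_ne_one L) w hw) (h⁻¹ * γ₂ * h) : ↥(unitaryGroupOfForm (galAdicCompletionMap (L := L) (IsCMField.complexConj L) hw) (placeForm (Matrix.of fun i j : Fin 2 => if i.val + j.val + 1 = 2 then (1 : L) else 0) w.1))) : GL (Fin 2) (w.1.adicCompletion L)) : Matrix (Fin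 2) (Fin 2) (w.1.adicCompletion L))) ∧
      ∃ (y : Fin 2 → (w.1.adicCompletion L)) (a : (w.1.adicCompletion L)), (∀ i, Valued.v (y i) ≤ 1) ∧ Valued.v a = 1 ∧
        Valued.v (ϖ₁ * ((fun i => (galAdicCompletionMap (L := L) (IsCMField.complexConj L) hw) (y i)) ⬝ᵥ (!![(0 : (w.1.adicCompletion L)), 1; 1, 0] *ᵥ ((((((localNonsplitEquiv (IsCMField.complexConj L) (Matrix.of fun i j : Fin 2 => if i.val + j.val + 1 = 2 then (1 : L) else 0) (IsCMField.complexConj_ne_one L) w hw) (h⁻¹ * γ₂ * h) : ↥(unitaryGroupOfForm (galAdicCompletionMap (L := L) (IsCMField.complexConj L) hw) (placeForm (Matrix.of fun i j : Fin 2 => if i.val + j.val + 1 = 2 then (1 : L) else 0) w.1))) : GL (Fin 2) (w.1.adicCompletion L)) : Matrix (Fin 2) (Fin 2) (w.1.adicCompletion L)) - c • (1 : Matrix (Fin 2) (Fin 2) (w.1.adicCompletion L))) *ᵥ y))) - c₀ * a ^ 2) < 1} =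
    Nat.card {x : ((cmDatum L 2 (Matrix.of fun i j : Fin 2 => if i.val + j.val + 1 = 2 then (1 : L) else 0)).Local v) ⧸ (cmLocalIntegralLevel L 2 (Matrix.of fun i j : Fin 2 => if i.val + j.val + 1 = 2 then (1 : L) else 0) v) | ∃ h : ((cmDatum L 2 (Matrix.of fun i j : Fin 2 => if i.val + j.val + 1 = 2 then (1 : L) else 0)).Local v), x = (h : ((cmDatum L 2 (Matrix.of fun i j : Fin 2 => if i.val + j.val + 1 = 2 then (1 : L) else 0)).Local v) ⧸ (cmLocalIntegralLevel L 2 (Matrix.of fun i j : Fin 2 => if i.val + j.val + 1 = 2 then (1 : L) else 0) v)) ∧ S (((((localNonsplitEquiv (IsCMField.complexConj L) (Matrix.of fun i j : Fin 2 => if i.val + j.val + 1 = 2 then (1 : L) else 0) (IsCMField.complexConj_ne_one L) w hw) (h⁻¹ * γ₂ * h) : ↥(unitaryGroupOfForm (galAdicCompletionMap (L := L) (IsCMField.complexConj L) hw) (placeForm (Matrix.of fun i j : Fin 2 => if i.val + j.val + 1 = 2 then (1 : L) else 0) w.1))) : GL (Fin 2) (w.1.adicCompletion L)) : Matrix (Fin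 2) (Fin 2) (w.1.adicCompletion L))) ∧
      ∃ (y : Fin 2 → (w.1.adicCompletion L)) (a : (w.1.adicCompletion L)), (∀ i, Valued.v (y i) ≤ 1) ∧ Valued.v a = 1 ∧
        Valued.v (ϖ₁ * ((fun i => (galAdicCompletionMap (L := L) (IsCMField.complexConj L) hw) (y i)) ⬝ᵥ (!![(0 : (w.1.adicCompletion L)), 1; 1, 0] *ᵥ ((((((localNonsplitEquiv (IsCMField.complexConj L) (Matrix.of fun i j : Fin 2 => if i.val + j.val + 1 = 2 then (1 : L) else 0) (IsCMField.complexConj_ne_one L) w hw) (h⁻¹ * γ₂ * h) : ↥(unitaryGroupOfForm (galAdicCompletionMap (L := L) (IsCMField.complexConj L) hw) (placeForm (Matrix.of fun i j : Fin 2 => if i.val + j.val + 1 = 2 then (1 : L) else 0) w.1))) : GL (Fin 2) (w.1.adicCompletion L)) : Matrix (Fin 2) (Fin 2) (w.1.adicCompletion L)) - c • (1 : Matrix (Fin 2) (Fin 2) (w.1.adicCompletion L))) *ᵥ y))) - c₁ * a ^ 2) < 1} := by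
  have hϖ0 : (ϖ : (w.1.adicCompletion L)) ≠ 0 := ϖ.ne_zero
  obtain ⟨h2v, -⟩ := valued_two_eq_one_of_isUnit_two_of_ramified L v w hw he h2
  have hu := coe_mem_unitaryGroupOfForm_antidiag_two_of_mem_placeForm L w hw ((localNonsplitEquiv (IsCMField.complexConj L) (Matrix.of fun i j : Fin 2 => if i.val + j.val + 1 = 2 then (1 : L) else 0) (IsCMField.complexConj_ne_one L) w hw) γ₂)
  obtain ⟨s, g, -, hsg⟩ := descent_of_mem_unitaryGroupOfForm_antidiag L v w hw hσϖ hϖ0 _ hu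
  obtain ⟨ε₀, hε₀, hns⟩ := exists_forall_valuation_sq_sub_eq_one L v h2v
  have hϖF := HeckeCharacter.valued_uniformizer (K := ↥(maximalRealSubfield L)) v
  obtain ⟨-, z, hz, hD, -⟩ := descent_trace_ne_zero_and_exists_eq_nonsquare_mul_sq_of_even_of_ramified L v w hw he h2v hu hirr hn1 hN hϖ0
    (g := (g : Matrix (Fin 2) (Fin 2) (v.adicCompletion ↥(maximalRealSubfield L)))) hsg hns hϖF
  exact natCard_class_eq_natCard_class_of_flip_scalar L v w hw he h2 γ₂
    (fun c' hc' => exists_classFlip_similitude_of_unit L v w hw he h2v ϖ hϖ hσϖ ((localNonsplitEquiv (IsCMField.complexConj L) (Matrix.of fun i j : Fin 2 => if i.val + j.val + 1 = 2 then (1 : L) else 0) (IsCMField.complexConj_ne_one L) w hw) γ₂) hsg hε₀ hns hz hD hc') S hS ϖ₁ c hc₀ hc₁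

set_option maxHeartbeats 1600000 in
include hw in
/-- **THE CLASS LAW AT ODD DEPTH, FREE CENTRING SCALAR** (★ 2e `natCard_class_eq_natCard_class_of_odd_depth_ramified` with `c` free; flip = ★ 2d
`exists_classFlip_similitude_of_unit_odd`). [cite: LabesseLanglands1979, §2 pp. 7–8] [cite: Rogawski1990, §4.9 p. 55] -/
theorem natCard_class_eq_natCard_class_of_odd_depth_ramified_scalar (he : v.asIdeal.ramificationIdx' w.1.asIdeal ≠ 1) (h2 : IsUnit (2 : 𝒪[(w.1.adicCompletion L)]))
    (ϖ : (w.1.adicCompletion L)ˣ) (hϖ : Valued.v (ϖ : (w.1.adicCompletion L)) = WithZero.exp (-1 : ℤ))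
    (hσϖ : (galAdicCompletionMap (L := L) (IsCMField.complexConj L) hw) (ϖ : (w.1.adicCompletion L)) = -(ϖ : (w.1.adicCompletion L)))
    (γ₂ : ((cmDatum L 2 (Matrix.of fun i j : Fin 2 => if i.val + j.val + 1 = 2 then (1 : L) else 0)).Local v))
    (hirr : ¬ ∃ x : (w.1.adicCompletion L), ((((((localNonsplitEquiv (IsCMField.complexConj L) (Matrix.of fun i j : Fin 2 => if i.val + j.val + 1 = 2 then (1 : L) else 0) (IsCMField.complexConj_ne_one L) w hw) (γ₂) : ↥(unitaryGroupOfForm (galAdicCompletionMap (L := L) (IsCMField.complexConj L) hw) (placeForm (Matrix.of fun i j : Fin 2 => if i.val + j.val + 1 = 2 then (1 : L) else 0) w.1))) : GL (Fin 2) (w.1.adicCompletion L)) : Matrix (Fin 2) (Fin 2) (w.1.adicCompletion L))).charpoly).IsRoot x)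
    {n : ℕ} (hN : Valued.v ((((((localNonsplitEquiv (IsCMField.complexConj L) (Matrix.of fun i j : Fin 2 => if i.val + j.val + 1 = 2 then (1 : L) else 0) (IsCMField.complexConj_ne_one L) w hw) (γ₂) : ↥(unitaryGroupOfForm (galAdicCompletionMap (L := L) (IsCMField.complexConj L) hw) (placeForm (Matrix.of fun i j : Fin 2 => if i.val + j.val + 1 = 2 then (1 : L) else 0) w.1))) : GL (Fin 2) (w.1.adicCompletion L)) : Matrix (Fin 2) (Fin 2) (w.1.adicCompletion L))).trace ^ 2 - 4 * (((((localNonsplitEquiv (IsCMField.complexConj L) (Matrix.of fun i j : Fin 2 => if i.val + j.val + 1 = 2 then (1 : L) else 0) (IsCMField.complexConj_ne_one L) w hw) (γ₂) : ↥(unitaryGroupOfForm (galAdicCompletionMap (L := L) (IsCMField.complexConj L) hw) (placeForm (Matrix.of fun i j : Fin 2 => if i.val + j.val + 1 = 2 then (1 : L) else 0) w.1))) : GL (Fin 2) (w.1.adicCompletion L)) : Matrix (Fin 2) (Fin 2) (w.1.adicCompletion L))).det) = WithZero.exp (-((2 * (2 * n + 1) : ℕ) : ℤ)))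
    (S : Matrix (Fin 2) (Fin 2) (w.1.adicCompletion L) → Prop) (hS : ∀ P : GL (Fin 2) (w.1.adicCompletion L), P ∈ glInt 2 (w.1.adicCompletion L) → ∀ Y : Matrix (Fin 2) (Fin 2) (w.1.adicCompletion L), S Y → S ((P : Matrix (Fin 2) (Fin 2) (w.1.adicCompletion L)) * Y * ((P⁻¹ : GL (Fin 2) (w.1.adicCompletion L)) : Matrix (Fin 2) (Fin 2) (w.1.adicCompletion L))))
    (ϖ₁ c : (w.1.adicCompletion L)) {c₀ c₁ : (w.1.adicCompletion L)} (hc₀ : Valued.v c₀ = 1) (hc₁ : Valued.v c₁ = 1) :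
    Nat.card {x : ((cmDatum L 2 (Matrix.of fun i j : Fin 2 => if i.val + j.val + 1 = 2 then (1 : L) else 0)).Local v) ⧸ (cmLocalIntegralLevel L 2 (Matrix.of fun i j : Fin 2 => if i.val + j.val + 1 = 2 then (1 : L) else 0) v) | ∃ h : ((cmDatum L 2 (Matrix.of fun i j : Fin 2 => if i.val + j.val + 1 = 2 then (1 : L) else 0)).Local v), x = (h : ((cmDatum L 2 (Matrix.of fun i j : Fin 2 => if i.val + j.val + 1 = 2 then (1 : L) else 0)).Local v) ⧸ (cmLocalIntegralLevel L 2 (Matrix.of fun i j : Fin 2 => if i.val + j.val + 1 = 2 then (1 : L) else 0) v)) ∧ S (((((localNonsplitEquiv (IsCMField.complexConj L) (Matrix.of fun i j : Fin 2 => if i.val + j.val + 1 = 2 then (1 : L) else 0) (IsCMField.complexConj_ne_one L) w hw) (h⁻¹ * γ₂ * h) : ↥(unitaryGroupOfForm (galAdicCompletionMap (L := L) (IsCMField.complexConj L) hw) (placeForm (Matrix.of fun i j : Fin 2 => if i.val + j.val + 1 = 2 then (1 : L) else 0) w.1))) : GL (Fin 2) (w.1.adicCompletion L)) : Matrix (Fin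 2) (Fin 2) (w.1.adicCompletion L))) ∧
      ∃ (y : Fin 2 → (w.1.adicCompletion L)) (a : (w.1.adicCompletion L)), (∀ i, Valued.v (y i) ≤ 1) ∧ Valued.v a = 1 ∧
        Valued.v (ϖ₁ * ((fun i => (galAdicCompletionMap (L := L) (IsCMField.complexConj L) hw) (y i)) ⬝ᵥ (!![(0 : (w.1.adicCompletion L)), 1; 1, 0] *ᵥ ((((((localNonsplitEquiv (IsCMField.complexConj L) (Matrix.of fun i j : Fin 2 => if i.val + j.val + 1 = 2 then (1 : L) else 0) (IsCMField.complexConj_ne_one L) w hw) (h⁻¹ * γ₂ * h) : ↥(unitaryGroupOfForm (galAdicCompletionMap (L := L) (IsCMField.complexConj L) hw) (placeForm (Matrix.of fun i j : Fin 2 => if i.val + j.val + 1 = 2 then (1 : L) else 0) w.1))) : GL (Fin 2) (w.1.adicCompletion L)) : Matrix (Fin 2) (Fin 2) (w.1.adicCompletion L)) - c • (1 : Matrix (Fin 2) (Fin 2) (w.1.adicCompletion L))) *ᵥ y))) - c₀ * a ^ 2) < 1} =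
    Nat.card {x : ((cmDatum L 2 (Matrix.of fun i j : Fin 2 => if i.val + j.val + 1 = 2 then (1 : L) else 0)).Local v) ⧸ (cmLocalIntegralLevel L 2 (Matrix.of fun i j : Fin 2 => if i.val + j.val + 1 = 2 then (1 : L) else 0) v) | ∃ h : ((cmDatum L 2 (Matrix.of fun i j : Fin 2 => if i.val + j.val + 1 = 2 then (1 : L) else 0)).Local v), x = (h : ((cmDatum L 2 (Matrix.of fun i j : Fin 2 => if i.val + j.val + 1 = 2 then (1 : L) else 0)).Local v) ⧸ (cmLocalIntegralLevel L 2 (Matrix.of fun i j : Fin 2 => if i.val + j.val + 1 = 2 then (1 : L) else 0) v)) ∧ S (((((localNonsplitEquiv (IsCMField.complexConj L) (Matrix.of fun i j : Fin 2 => if i.val + j.val + 1 = 2 then (1 : L) else 0) (IsCMField.complexConj_ne_one L) w hw) (h⁻¹ * γ₂ * h) : ↥(unitaryGroupOfForm (galAdicCompletionMap (L := L) (IsCMField.complexConj L) hw) (placeForm (Matrix.of fun i j : Fin 2 => if i.val + j.val + 1 = 2 then (1 : L) else 0) w.1))) : GL (Fin 2) (w.1.adicCompletion L)) : Matrix (Fin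 2) (Fin 2) (w.1.adicCompletion L))) ∧
      ∃ (y : Fin 2 → (w.1.adicCompletion L)) (a : (w.1.adicCompletion L)), (∀ i, Valued.v (y i) ≤ 1) ∧ Valued.v a = 1 ∧
        Valued.v (ϖ₁ * ((fun i => (galAdicCompletionMap (L := L) (IsCMField.complexConj L) hw) (y i)) ⬝ᵥ (!![(0 : (w.1.adicCompletion L)), 1; 1, 0] *ᵥ ((((((localNonsplitEquiv (IsCMField.complexConj L) (Matrix.of fun i j : Fin 2 => if i.val + j.val + 1 = 2 then (1 : L) else 0) (IsCMField.complexConj_ne_one L) w hw) (h⁻¹ * γ₂ * h) : ↥(unitaryGroupOfForm (galAdicCompletionMap (L := L) (IsCMField.complexConj L) hw) (placeForm (Matrix.of fun i j : Fin 2 => if i.val + j.val + 1 = 2 then (1 : L) else 0) w.1))) : GL (Fin 2) (w.1.adicCompletion L)) : Matrix (Fin 2) (Fin 2) (w.1.adicCompletion L)) - c • (1 : Matrix (Fin 2) (Fin 2) (w.1.adicCompletion L))) *ᵥ y))) - c₁ * a ^ 2) < 1} := by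
  have hϖ0 : (ϖ : (w.1.adicCompletion L)) ≠ 0 := ϖ.ne_zero
  obtain ⟨h2v, -⟩ := valued_two_eq_one_of_isUnit_two_of_ramified L v w hw he h2
  have hu := coe_mem_unitaryGroupOfForm_antidiag_two_of_mem_placeForm L w hw ((localNonsplitEquiv (IsCMField.complexConj L) (Matrix.of fun i j : Fin 2 => if i.val + j.val + 1 = 2 then (1 : L) else 0) (IsCMField.complexConj_ne_one L) w hw) γ₂)
  obtain ⟨s, g, -, hsg⟩ := descent_of_mem_unitaryGroupOfForm_antidiag L v w hw hσϖ hϖ0 _ hu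
  obtain ⟨ε₀, -, hns⟩ := exists_forall_valuation_sq_sub_eq_one L v h2v
  have hϖF := HeckeCharacter.valued_uniformizer (K := ↥(maximalRealSubfield L)) v
  obtain ⟨-, hpar⟩ := descent_trace_ne_zero_and_parity_of_mem_unitaryGroupOfForm_of_ramified L v w hw he h2v hu hirr (N := 2 * n + 1) (by omega) hN hϖ0
    (g := (g : Matrix (Fin 2) (Fin 2) (v.adicCompletion ↥(maximalRealSubfield L)))) hsg (ε₀ := ε₀)
    (fun b hb => (v_eq_one_iff_valuation_eq_one _).2 (hns b ((Valuation.mem_integer_iff _ _).2 ((v_le_one_iff_valuation_le_one b).1 hb)))) hϖF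
  rcases hpar with ⟨m, hm, -⟩ | ⟨m, -, π₁, z, hπ₁, hz, hD, -⟩
  · exact absurd hm (by omega)
  · rw [hϖF] at hπ₁
    exact natCard_class_eq_natCard_class_of_flip_scalar L v w hw he h2 γ₂
      (fun c' hc' => exists_classFlip_similitude_of_unit_odd L v w hw he h2v ϖ hϖ hσϖ ((localNonsplitEquiv (IsCMField.complexConj L) (Matrix.of fun i j : Fin 2 => if i.val + j.val + 1 = 2 then (1 : L) else 0) (IsCMField.complexConj_ne_one L) w hw) γ₂) hirr hsg hπ₁ hz hD hc') S hS ϖ₁ c hc₀ hc₁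

end ParityScalar

end Literature.NumberTheory.Automorphic.UnitaryGroup

end
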